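import Summits.ValiantsHypothesis.ValiantsHypothesis.Theses.RealTau

/-!
# Crux `RealTau.RealVnTransfer` (stmt-ValiantsHypothesis-18102), line `realified-depth-four` —
# registered stub `stub_realLiftData`

**Tavenas' Cor. 3.37 over `ℝ` with a complexity bound** (thesis 2014, Cor. 3.37 p. 54 and the
first lines of the proof of Prop. 3.21: "`D_n` est une projection de `C_{q(n)}`"): if `PER` is
p-computable over `ℝ` then for some `e` and every `n` there is a multilinear
`H_n ∈ ℝ[x_0, …, x_{2n+2}, z_0, …, z_{2n+2}]` with `L_ℝ(H_n) ≤ (n+2)^e` and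
`H_n(X^{2^j}; 2^{2^i}) = V_n` in `ℝ[X]`.

Proof: take the tree's `Tavenas2014_cor_3_37_holds` — a p-bounded `q` and, for every `n`, a
multilinear `h_n ∈ ℚ[x, z]` that is a projection of `PER_{q(n)}` over `ℚ` with
`h_n(X^{2^j}; 2^{2^i}) = V_n` in `ℚ[X]` — and put `H_n := h_n ⊗_ℚ ℝ`
(`MvPolynomial.map (algebraMap ℚ ℝ) h_n`).  Then
* `H_n` is a projection of `PER_{q(n)}` over `ℝ` (`isProjection_map`, `map_perPoly`), hence
  `L_ℝ(H_n) ≤ L_ℝ(PER_{q(n)}) ≤ (n+2)^e` (projections are free, `IsProjection.complexity_le_holds`;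
  `IsPBounded.comp_holds`, `IsPBounded.exists_le_pow`) — the one point where "with constants"
  matters;
* `H_n` is multilinear (`support_map_subset`);
* the substitution identity is Cor. 3.37's identity mapped along `ℚ → ℝ`
  (`aeval_map_algebraMap`, `comp_aeval_apply` for the `ℚ`-algebra map `ℚ[X] → ℝ[X]`).

Unconditional (axioms `propext`, `Classical.choice`, `Quot.sound`). References: S. Tavenas,
*Bornes inférieures et supérieures dans les circuits arithmétiques*, PhD thesis, ENS Lyon 2014,
Cor. 3.37; P. Bürgisser, *Completeness and Reduction in Algebraic Complexity Theory*, Springer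
2000, Rem. 2.7.
-/

noncomputable section

-- single-conjunct layout: Sub = Summit, duplicated namespace component intended
set_option linter.dupNamespace false

namespace Summit.ValiantsHypothesis.ValiantsHypothesis.Theorems.RealTauRealVnTransfer

open MvPolynomial Literature.Computability.AlgebraicComplexity

/-- **The substitution (3.1) commutes with base change `ℚ → ℝ`**: for `h ∈ ℚ[x, z]`,
`(h ⊗ ℝ)(X^{2^j} ⊗ ℝ; 2^{2^i}) = h(X^{2^j}; 2^{2^i}) ⊗ ℝ` in `ℝ[X]` (the `ℚ`-algebra map
`ℚ[X] → ℝ[X]` commutes with evaluation). [cite: Tavenas2014, Cor. 3.37] -/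
theorem aeval_map_kpSubst_map {d r : ℕ} (h : MvPolynomial (Fin d ⊕ Fin r) ℚ) :
    MvPolynomial.aeval (fun x => (kpSubst d r x).map (algebraMap ℚ ℝ))
        (MvPolynomial.map (algebraMap ℚ ℝ) h) =
      (MvPolynomial.aeval (kpSubst d r) h).map (algebraMap ℚ ℝ) := by
  rw [MvPolynomial.aeval_map_algebraMap, ← Polynomial.mapAlg_eq_map,
    MvPolynomial.comp_aeval_apply]
  rfl

/-- **LIFT DATA — Cor. 3.37 over `ℝ` with a complexity bound** (thesis 2014, Cor. 3.37 p. 54 and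
the first lines of the proof of Prop. 3.21: "`D_n` est une projection de `C_{q(n)}`"): if `PER` is
p-computable over `ℝ` then for some `e` and every `n` there is a multilinear
`H_n ∈ ℝ[x_0..x_{2n+2}, z_0..z_{2n+2}]` with `L_ℝ(H_n) ≤ (n+2)^e` and
`H_n(X^{2^j}; 2^{2^i}) = V_n` in `ℝ[X]` — namely `H_n = h_n ⊗ ℝ` for the tree's
`Tavenas2014_cor_3_37_holds` (`isProjection_map`, `map_perPoly`,
`IsProjection.complexity_le_holds`, `IsPBounded.comp_holds`, `support_map_subset`, and the
substitution identity mapped along `ℚ → ℝ`). [cite: Tavenas2014, Cor. 3.37; Burgisser2000, Rem. 2.7] -/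
theorem stub_realLiftData :
    IsPComputable (fun n => perPoly (Fin n) ℝ) →
      ∃ e : ℕ, ∀ n, ∃ H : MvPolynomial (Fin (2 * n + 3) ⊕ Fin (2 * n + 3)) ℝ,
        complexity H ≤ (n + 2) ^ e ∧ (∀ m ∈ H.support, ∀ x, m x ≤ 1) ∧
          MvPolynomial.aeval
              (fun x => (kpSubst (2 * n + 3) (2 * n + 3) x).map (algebraMap ℚ ℝ)) H =
            (tavenasV n).map (Int.castRingHom ℝ) := by
  intro hR
  -- Tavenas' family over `ℚ` and the real complexity of the permanent
  obtain ⟨q, hq, Hh⟩ := Tavenas2014_cor_3_37_holds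
  obtain ⟨e₁, he₁⟩ :=
    (IsPBounded.comp_holds (s := fun n => complexity (perPoly (Fin n) ℝ)) hR hq).exists_le_pow
  refine ⟨e₁, fun n => ?_⟩
  obtain ⟨h, hproj, hml, hsub⟩ := Hh n
  refine ⟨MvPolynomial.map (algebraMap ℚ ℝ) h, ?_, fun m hm x => ?_, ?_⟩
  · -- projections with rational constants are free for `complexity`
    have hp : IsProjection (MvPolynomial.map (algebraMap ℚ ℝ) h) (perPoly (Fin (q n)) ℝ) := by
      have :=
        Summit.ValiantsHypothesis.ValiantsHypothesis.Theorems.SymmetroidDescartes.isProjection_map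
          (algebraMap ℚ ℝ) hproj
      rwa [map_perPoly] at this
    exact (IsProjection.complexity_le_holds hp).trans (he₁ n)
  · -- multilinearity survives the base change
    exact hml m (support_map_subset _ _ hm) x
  · -- the substitution identity, mapped along `ℚ → ℝ`
    rw [aeval_map_kpSubst_map, hsub, Polynomial.map_map,
      RingHom.ext_int ((algebraMap ℚ ℝ).comp (Int.castRingHom ℚ)) (Int.castRingHom ℝ)]

end Summit.ValiantsHypothesis.ValiantsHypothesis.Theorems.RealTauRealVnTransfer

end
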